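import Summits.QuantumFields.YangMills.Theorems.UnitScaleTiltProp7SymAvgGLBridge
import Summits.QuantumFields.YangMills.Theorems.UnitScaleTiltProp8ChartDeriv
import HarnessLib

/-!
# Route `UnitScaleTilt`, crux K1 child «MinimiserStabilityRegPr» (stmt-QuantumFields-19200), stub EX, route (α), node (AVG-SYM), row **(AVG-SYM-P12)-flat** —
# **THE DEFINED LINEARISATION `QSym` OF THE SYMMETRIC LOG-CHART AT THE FLAT BACKGROUND IS THE EXPLICIT (0.4)-LINEAR AVERAGE**:
# `QSym F n K h 1 = fieldShift ∘ Q^{(K−n)}` (★w1-19200 g2's `QSym := fderiv ℂ (logChartSym U₀) 0` at `U₀ = 1`; `Q^{(i)}` the composites of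
# `BlockAveragingEMLLinearised.linAvg`, the letter of (J5) `Prop7DescendJunction` and of p1's `Prop8Chart.fderiv_chartLog_zero_apply`)

Cell `ym3-torus`, width seat `ym-ust-19200-w2` (gen 2; OWNER 2026-08-28T02:59:25Z (c): «socket (AVG-SYM-P12)-flat: `QSym F n K h (U₀ := 1) = fieldShift ∘ Q (K−n)` … the base
point of ★w3-20520's (AVG-SYM-46) Neumann series»).  THEOREMS ONLY (0 `def`, 0 `sorry`).  YM₃ on T³ is a ladder rung (R3), not the Clay problem; nothing here claims the stub,
the crux, d = 4 or the mass gap.  `--supports stmt-QuantumFields-19200 --as helper`; count-neutral.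

THE PRINT.  [Balaban1985Variational] (44) p. 285: *«Q_j(ηA) = LʲηQ_jA + C_j(LʲηA)»* — the averaging operation in log coordinates is its LINEAR part plus a quadratic remainder;
[Balaban1985Averaging] Prop. 3 (124)–(125) p. 36: the linearisation of the average at a configuration is the (contour-)average of the bond variables along the paths;
[Balaban1987RG1] (0.4) p. 253 (the symmetric average), (0.21) p. 256 (its linearisation).  In the tree the symmetric chart's linear part is a DEFINITION
(`Prop7SymAvgGL.QSym U₀ := fderiv ℂ (logChartSym U₀) 0`, p599598, «(AVG-SYM-P12) is NOT here»); this file computes it at the flat background.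

THE COMPUTATION (no estimate; p1's flat calculus by name).  At `U₀ = 1`: `bgUnits F K 1 = 1` (`unitsField_toUField_one`), so the perturbed field is `b ↦ e^{A(b)}`
(`expUnit`), the reference descent is `D̄(1) = 1` (★w1's bridge `descendToGL_eq_fieldShift_emlIterU` + p1's `emlIterU_one`), and
`logChartSym 1 A c = log[(Ū^{(K−n)}(e^{A}))(bondShift c)]` (`logChartSym_one_apply`).  LEVEL BY LEVEL at `A = 0` every iterate is the flat field, the bond chart
`A ↦ e^{A(b)}` has derivative `Y ↦ Y(b)` (`hasFDerivAt_exp_zero`), and p1's `Prop8Chart.hasFDerivAt_coe_emlAvgU_flat` («the derivative of the unguarded (0.4) average at the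
flat configuration is the linearised average of the bond derivatives») advances the induction: `D[Ū^{(i)}(e^{A})(c)](0)·Y = Q^{(i)}Y(c)`
(`exists_hasFDerivAt_coe_emlIterU_expUnit_zero` — p1's `exists_hasFDerivAt_coe_emlIterU_expCfg_zero` with the factor `iη` replaced by `1`); `D log(1) = id`
(`hasFDerivAt_mlog_one`); uniqueness of the Fréchet derivative (`HasFDerivAt.fderiv`).

WHAT IS PROVED.  `bgUnits_one`, `descendToGL_one`, `logChartSym_one_apply`; `exists_hasFDerivAt_coe_emlIterU_expUnit_zero`;
★ **`hasFDerivAt_logChartSym_one`** (the log-chart IS Fréchet-differentiable at `0` at the flat background — a THEOREM here, not an (AN) hypothesis — with derivative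
the `pi` of the level-`(K−n)` linear averages read through `bondShift`); ★★ **`QSym_one_apply : QSym F n K h 1 Y c = Q (K − n) Y (bondShift … c)`** for EVERY family `Q`
with `Q 0 = id`, `Q (i+1) = linAvg ∘ Q i` (the (J5) ∕ P3 letter) — the base point of the (AVG-SYM-46) Neumann series; `differentiableAt_logChartSym_one`.

HONEST SCOPE.  Flat background only (`U₀ = 1`); at a curved `U₀` the identification of `QSym U₀` with a covariant contour average is (AVG-SYM-P12) proper (not here).  Pure
calculus over landed definitions; nothing of [Balaban1985Averaging] §§B–C is asserted.

References: T. Bałaban, CMP 102 (1985) 277–309 [Balaban1985Variational] ((44) p.285); CMP 98 (1985) 17–51 [Balaban1985Averaging] (Prop. 3 (124)–(125) p.36, Prop. 4 p.38);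
CMP 109 (1987) 249–301 [Balaban1987RG1] ((0.4) p.253, (0.11) p.253, (0.21) p.256).
-/

noncomputable section

open scoped BigOperators Matrix.Norms.L2Operator
open NormedSpace

namespace Summit.QuantumFields.YangMills.Theorems.Prop7QSymFlat

open Literature.MathematicalPhysics.QuantumFieldTheory.Balaban1983to89
open T3ContinuumYM3Torus
open T3SectALandauChart (bgUnits)
open T3LevelShift (fieldShift bondShift fieldShift_apply)
open T3PrintedRegularMinimiser (unitsField_toUField_one)
open B7Prop1Explicit (expUnit val_expUnit)
open B7TransferAnalyticMean (hasFDerivAt_mlog_one)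
open BlockAveragingEMLLinearised (linAvg linAvg_def walkSum)
open MatrixLog (mlog)
open Summit.QuantumFields.YangMills.Theorems.Prop8Chart (emlAvgU emlIterU emlIterU_zero emlIterU_succ emlIterU_one hasFDerivAt_coe_emlAvgU_flat walkSum_apply)
open Summit.QuantumFields.YangMills.Theorems.Prop7SymAvgGL (logChartSym QSym descendToGL descendToGL_eq_fieldShift_emlIterU)

/-! ## §1 The flat background in the symmetric chart's letters -/

section Flat

variable (F : T3Family) (n K : ℕ) (h : n ≤ K)

/-- At `U₀ = 1` the units background is the flat field. [cite: Balaban1985Averaging, (19) p.21] -/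
theorem bgUnits_one : bgUnits F K (1 : GaugeField (F.P K) 0 (Matrix.specialUnitaryGroup (Fin 2) ℂ)) = fun _ => 1 :=
  unitsField_toUField_one

/-- The perturbed field at the flat background is `b ↦ e^{A(b)}`. [cite: Balaban1985Variational, (51) p.286] -/
theorem expUnit_mul_bgUnits_one (A : PBond (F.P K) 0 → Matrix (Fin 2) (Fin 2) ℂ) :
    (fun b : PBond (F.P K) 0 => expUnit (A b) * bgUnits F K (1 : GaugeField (F.P K) 0 (Matrix.specialUnitaryGroup (Fin 2) ℂ)) b) = fun b => expUnit (A b) := by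
  funext b
  rw [bgUnits_one, mul_one]

/-- **The complexified descent of the flat field is flat**: `D̄_{n,K}(1) = 1` (★w1's bridge + p1's `emlIterU_one`). [cite: Balaban1987RG1, (0.4) p.253] -/
theorem descendToGL_one : descendToGL F n K h (fun _ : PBond (F.P K) 0 => (1 : (Matrix (Fin 2) (Fin 2) ℂ)ˣ)) = fun _ => 1 := by
  rw [descendToGL_eq_fieldShift_emlIterU]
  funext c
  rw [fieldShift_apply]
  have h1 := congr_fun (emlIterU_one (P := F.P K) (𝔸 := Matrix (Fin 2) (Fin 2) ℂ) (K - n))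
    (bondShift (F.sitesPerDir_eq (m := F.m) (K := n) (j := 0) (m' := F.m) (K' := K) (j' := K - n) (by omega)) c)
  exact h1

/-- **THE LOG-CHART AT THE FLAT BACKGROUND**: `logChartSym 1 A c = log[(Ū^{(K−n)}(e^{A}))(bondShift c)]` (the reference factor `D̄(1)(c)⁻¹ = 1` drops).
[cite: Balaban1985Variational, (44) p.285; Balaban1987RG1, (0.4)+(0.11) p.253] -/
theorem logChartSym_one_apply (A : PBond (F.P K) 0 → Matrix (Fin 2) (Fin 2) ℂ) (c : PBond (F.P n) 0) :
    logChartSym F n K h 1 A c =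
      mlog ((emlIterU (K - n) (fun b : PBond (F.P K) 0 => expUnit (A b))
        (bondShift (F.sitesPerDir_eq (m := F.m) (K := n) (j := 0) (m' := F.m) (K' := K) (j' := K - n) (by omega)) c) :
          (Matrix (Fin 2) (Fin 2) ℂ)ˣ) : Matrix (Fin 2) (Fin 2) ℂ) := by
  unfold logChartSym
  rw [expUnit_mul_bgUnits_one, bgUnits_one, descendToGL_one, descendToGL_eq_fieldShift_emlIterU, fieldShift_apply, inv_one, Units.val_one, mul_one]
  rfl

end Flat

/-! ## §2 Level by level at `A = 0` with the `expUnit` chart (p1's induction with the factor `iη` replaced by `1`) -/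

section Levels

variable {P : Params} {m : Type*} [Fintype m] [DecidableEq m]

/-- The bond chart `A ↦ e^{A(b)}` has derivative `Y ↦ Y(b)` at `A = 0`. [cite: Balaban1985Variational, (51) p.286] -/
theorem hasFDerivAt_coe_expUnit_zero (b : PBond P 0) :
    HasFDerivAt (fun A : PBond P 0 → Matrix m m ℂ => ((expUnit (A b) : (Matrix m m ℂ)ˣ) : Matrix m m ℂ))
      (ContinuousLinearMap.proj (R := ℂ) (φ := fun _ : PBond P 0 => Matrix m m ℂ) b) 0 := by
  have hfun : (fun A : PBond P 0 → Matrix m m ℂ => ((expUnit (A b) : (Matrix m m ℂ)ˣ) : Matrix m m ℂ)) =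
      fun A => exp ((ContinuousLinearMap.proj (R := ℂ) (φ := fun _ : PBond P 0 => Matrix m m ℂ) b) A) := by
    funext A; rw [val_expUnit]; rfl
  rw [hfun]
  have hexp : HasFDerivAt (exp : Matrix m m ℂ → Matrix m m ℂ) (1 : Matrix m m ℂ →L[ℂ] Matrix m m ℂ)
      ((ContinuousLinearMap.proj (R := ℂ) (φ := fun _ : PBond P 0 => Matrix m m ℂ) b) 0) := by
    rw [map_zero]; exact hasFDerivAt_exp_zero
  have hc := hexp.comp (0 : PBond P 0 → Matrix m m ℂ) (ContinuousLinearMap.proj (R := ℂ) (φ := fun _ : PBond P 0 => Matrix m m ℂ) b).hasFDerivAt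
  rwa [ContinuousLinearMap.one_def, ContinuousLinearMap.id_comp] at hc

/-- At `A = 0` the `expUnit` field is flat. [folklore] -/
theorem expUnit_field_zero : (fun b : PBond P 0 => expUnit ((0 : PBond P 0 → Matrix m m ℂ) b)) = fun _ => 1 := by
  funext b
  apply Units.ext
  rw [val_expUnit, Pi.zero_apply, exp_zero, Units.val_one]

/-- **LEVEL BY LEVEL: `D[Ū^{(i)}(e^{A})(c)](0)·Y = Q^{(i)}Y(c)`** for any family `Q^{(i)}` with `Q^{(0)} = id`, `Q^{(i+1)} = linAvg ∘ Q^{(i)}` — p1's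
`Prop8Chart.exists_hasFDerivAt_coe_emlIterU_expCfg_zero` for the `expUnit` chart (factor `1` instead of `iη`): base `hasFDerivAt_coe_expUnit_zero`, step
`Prop8Chart.hasFDerivAt_coe_emlAvgU_flat` (at `A = 0` every iterate is the flat field). [cite: Balaban1985Averaging, Prop. 3 (124)-(125) p.36, Prop. 4 p.38; Balaban1987RG1, (0.21) p.256] -/
theorem exists_hasFDerivAt_coe_emlIterU_expUnit_zero [Nonempty m]
    (Q : (i : ℕ) → (PBond P 0 → Matrix m m ℂ) → PBond P i → Matrix m m ℂ)
    (hQ0 : ∀ Y, Q 0 Y = Y) (hQs : ∀ (i : ℕ) (Y : PBond P 0 → Matrix m m ℂ) (c : PBond P (i + 1)), Q (i + 1) Y c = linAvg (Q i Y) c) :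
    ∀ (i : ℕ) (c : PBond P i), ∃ D : (PBond P 0 → Matrix m m ℂ) →L[ℂ] Matrix m m ℂ,
      HasFDerivAt (fun A : PBond P 0 → Matrix m m ℂ => ((emlIterU i (fun b : PBond P 0 => expUnit (A b)) c : (Matrix m m ℂ)ˣ) : Matrix m m ℂ)) D 0 ∧
        ∀ Y, D Y = Q i Y c := by
  intro i
  induction i with
  | zero =>
    intro b
    refine ⟨ContinuousLinearMap.proj (R := ℂ) (φ := fun _ : PBond P 0 => Matrix m m ℂ) b, ?_, fun Y => ?_⟩
    · simpa only [emlIterU_zero] using hasFDerivAt_coe_expUnit_zero (P := P) (m := m) b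
    · rw [hQ0]; rfl
  | succ i ih =>
    intro c
    choose D hD hDQ using ih
    have h1 : ∀ b : PBond P i, emlIterU i (fun b' : PBond P 0 => expUnit ((0 : PBond P 0 → Matrix m m ℂ) b')) b = 1 := fun b => by
      rw [expUnit_field_zero, emlIterU_one]
    have hstep := hasFDerivAt_coe_emlAvgU_flat (F := fun A : PBond P 0 → Matrix m m ℂ => emlIterU i (fun b : PBond P 0 => expUnit (A b))) (F' := D) hD h1 c
    refine ⟨_, by simpa only [emlIterU_succ] using hstep, fun Y => ?_⟩
    simp only [smul_apply, sum_apply, add_apply, sub_apply, walkSum_apply, hDQ]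
    rw [← linAvg_def (fun b => Q i Y b) c, hQs]

end Levels

/-! ## §3 `QSym 1 = fieldShift ∘ Q^{(K−n)}` -/

section Main

variable (F : T3Family) {n K : ℕ} (h : n ≤ K)

/-- ★ **THE SYMMETRIC LOG-CHART IS FRÉCHET-DIFFERENTIABLE AT `0` AT THE FLAT BACKGROUND, WITH DERIVATIVE THE LEVEL-`(K−n)` LINEAR AVERAGE READ THROUGH `bondShift`**:
for any `(J5)`-family `Q`, `HasFDerivAt (logChartSym F n K h 1) (pi_c [Y ↦ Q^{(K−n)}Y(bondShift c)]) 0` — a THEOREM (not an (AN) hypothesis) at `U₀ = 1`: §2 composed with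
`D log(1) = id` (`hasFDerivAt_mlog_one`). [cite: Balaban1985Variational, (44) p.285; Balaban1985Averaging, Prop. 3 (124)-(125) p.36] -/
theorem hasFDerivAt_logChartSym_one
    (Q : (i : ℕ) → (PBond (F.P K) 0 → Matrix (Fin 2) (Fin 2) ℂ) → PBond (F.P K) i → Matrix (Fin 2) (Fin 2) ℂ)
    (hQ0 : ∀ Y, Q 0 Y = Y)
    (hQs : ∀ (i : ℕ) (Y : PBond (F.P K) 0 → Matrix (Fin 2) (Fin 2) ℂ) (c : PBond (F.P K) (i + 1)), Q (i + 1) Y c = linAvg (Q i Y) c) :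
    ∃ D : (PBond (F.P K) 0 → Matrix (Fin 2) (Fin 2) ℂ) →L[ℂ] (PBond (F.P n) 0 → Matrix (Fin 2) (Fin 2) ℂ),
      HasFDerivAt (logChartSym F n K h 1) D 0 ∧
        ∀ (Y : PBond (F.P K) 0 → Matrix (Fin 2) (Fin 2) ℂ) (c : PBond (F.P n) 0),
          D Y c = Q (K - n) Y (bondShift (F.sitesPerDir_eq (m := F.m) (K := n) (j := 0) (m' := F.m) (K' := K) (j' := K - n) (by omega)) c) := by
  choose Dm hDm hDmQ using fun c : PBond (F.P n) 0 =>
    exists_hasFDerivAt_coe_emlIterU_expUnit_zero (P := F.P K) (m := Fin 2) Q hQ0 hQs (K - n)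
      (bondShift (F.sitesPerDir_eq (m := F.m) (K := n) (j := 0) (m' := F.m) (K' := K) (j' := K - n) (by omega)) c)
  -- per coarse bond: `log` at `1`
  have hc : ∀ c : PBond (F.P n) 0, HasFDerivAt (fun A : PBond (F.P K) 0 → Matrix (Fin 2) (Fin 2) ℂ => logChartSym F n K h 1 A c)
      ((1 : Matrix (Fin 2) (Fin 2) ℂ →L[ℂ] Matrix (Fin 2) (Fin 2) ℂ).comp (Dm c)) 0 := by
    intro c
    have hfun : (fun A : PBond (F.P K) 0 → Matrix (Fin 2) (Fin 2) ℂ => logChartSym F n K h 1 A c) =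
        fun A => mlog ((emlIterU (K - n) (fun b : PBond (F.P K) 0 => expUnit (A b))
          (bondShift (F.sitesPerDir_eq (m := F.m) (K := n) (j := 0) (m' := F.m) (K' := K) (j' := K - n) (by omega)) c) :
            (Matrix (Fin 2) (Fin 2) ℂ)ˣ) : Matrix (Fin 2) (Fin 2) ℂ) := by
      funext A; exact logChartSym_one_apply F n K h A c
    rw [hfun]
    have hval : ((emlIterU (K - n) (fun b : PBond (F.P K) 0 => expUnit ((0 : PBond (F.P K) 0 → Matrix (Fin 2) (Fin 2) ℂ) b))
        (bondShift (F.sitesPerDir_eq (m := F.m) (K := n) (j := 0) (m' := F.m) (K' := K) (j' := K - n) (by omega)) c) :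
          (Matrix (Fin 2) (Fin 2) ℂ)ˣ) : Matrix (Fin 2) (Fin 2) ℂ) = 1 := by
      rw [expUnit_field_zero, emlIterU_one, Units.val_one]
    have hlog : HasFDerivAt (mlog : Matrix (Fin 2) (Fin 2) ℂ → Matrix (Fin 2) (Fin 2) ℂ) (1 : Matrix (Fin 2) (Fin 2) ℂ →L[ℂ] Matrix (Fin 2) (Fin 2) ℂ)
        ((emlIterU (K - n) (fun b : PBond (F.P K) 0 => expUnit ((0 : PBond (F.P K) 0 → Matrix (Fin 2) (Fin 2) ℂ) b))
          (bondShift (F.sitesPerDir_eq (m := F.m) (K := n) (j := 0) (m' := F.m) (K' := K) (j' := K - n) (by omega)) c) :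
            (Matrix (Fin 2) (Fin 2) ℂ)ˣ) : Matrix (Fin 2) (Fin 2) ℂ) := by
      rw [hval]; exact hasFDerivAt_mlog_one
    have hcomp := hlog.comp (0 : PBond (F.P K) 0 → Matrix (Fin 2) (Fin 2) ℂ) (hDm c)
    exact hcomp
  refine ⟨ContinuousLinearMap.pi fun c : PBond (F.P n) 0 => (1 : Matrix (Fin 2) (Fin 2) ℂ →L[ℂ] Matrix (Fin 2) (Fin 2) ℂ).comp (Dm c),
    hasFDerivAt_pi.mpr hc, fun Y c => ?_⟩
  rw [ContinuousLinearMap.pi_apply, ContinuousLinearMap.comp_apply, one_apply_eq_self, hDmQ]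

/-- The symmetric log-chart is differentiable at `0` at the flat background (so `QSym 1` is a genuine derivative, not the junk value of `fderiv`).
[cite: Balaban1985Variational, (44) p.285] -/
theorem differentiableAt_logChartSym_one : DifferentiableAt ℂ (logChartSym F n K h 1) 0 := by
  obtain ⟨D, hD, -⟩ := hasFDerivAt_logChartSym_one F h (fun i Y => Nat.rec (motive := fun i => PBond (F.P K) i → Matrix (Fin 2) (Fin 2) ℂ) Y
    (fun i Z c => linAvg Z c) i) (fun Y => rfl) (fun i Y c => rfl)
  exact hD.differentiableAt

/-- ★★ **(AVG-SYM-P12)-flat: `QSym F n K h 1 = fieldShift ∘ Q^{(K−n)}`** — the DEFINED linear part of the symmetric log-chart at the flat background is the explicit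
(0.4)-linear average: for every family `Q` with `Q^{(0)} = id`, `Q^{(i+1)} = linAvg ∘ Q^{(i)}` (the letter of (J5) `Prop7DescendJunction.norm_descendTo_sub_one_le_and_sub_lin_le`
and of p1's `Prop8Chart.fderiv_chartLog_zero_apply`), every fine one-form `Y` and every coarse bond `c`: `QSym 1 Y c = Q^{(K−n)} Y (bondShift c)`.  The base point of the
(AVG-SYM-46) Neumann series. [cite: Balaban1985Variational, (44) p.285; Balaban1985Averaging, Prop. 3 (124)-(125) p.36; Balaban1987RG1, (0.21) p.256] -/
theorem QSym_one_apply
    (Q : (i : ℕ) → (PBond (F.P K) 0 → Matrix (Fin 2) (Fin 2) ℂ) → PBond (F.P K) i → Matrix (Fin 2) (Fin 2) ℂ)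
    (hQ0 : ∀ Y, Q 0 Y = Y)
    (hQs : ∀ (i : ℕ) (Y : PBond (F.P K) 0 → Matrix (Fin 2) (Fin 2) ℂ) (c : PBond (F.P K) (i + 1)), Q (i + 1) Y c = linAvg (Q i Y) c)
    (Y : PBond (F.P K) 0 → Matrix (Fin 2) (Fin 2) ℂ) (c : PBond (F.P n) 0) :
    QSym F n K h 1 Y c = Q (K - n) Y (bondShift (F.sitesPerDir_eq (m := F.m) (K := n) (j := 0) (m' := F.m) (K' := K) (j' := K - n) (by omega)) c) := by
  obtain ⟨D, hD, hDQ⟩ := hasFDerivAt_logChartSym_one F h Q hQ0 hQs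
  unfold QSym
  rw [hD.fderiv, hDQ]

/-- The same as an identity of functions of `(Y, c)`. [cite: Balaban1985Variational, (44) p.285] -/
theorem QSym_one_eq
    (Q : (i : ℕ) → (PBond (F.P K) 0 → Matrix (Fin 2) (Fin 2) ℂ) → PBond (F.P K) i → Matrix (Fin 2) (Fin 2) ℂ)
    (hQ0 : ∀ Y, Q 0 Y = Y)
    (hQs : ∀ (i : ℕ) (Y : PBond (F.P K) 0 → Matrix (Fin 2) (Fin 2) ℂ) (c : PBond (F.P K) (i + 1)), Q (i + 1) Y c = linAvg (Q i Y) c) :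
    (fun Y => QSym F n K h 1 Y) =
      fun Y => fieldShift (F.sitesPerDir_eq (m := F.m) (K := n) (j := 0) (m' := F.m) (K' := K) (j' := K - n) (by omega)) (Q (K - n) Y) := by
  funext Y c
  rw [QSym_one_apply F h Q hQ0 hQs, fieldShift_apply]

end Main

end Summit.QuantumFields.YangMills.Theorems.Prop7QSymFlat

end
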